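import Literature.AlgebraicGeometry.Morphisms.EtaleLocusFibresCharZero
import Literature.AlgebraicGeometry.Morphisms.FiniteEtaleGeometricFibreCard
import Literature.AlgebraicGeometry.HodgeTheory.FiniteFlatRankOfDegree
import Literature.AlgebraicGeometry.Resolution.GabberTemkinAlterations
import HarnessLib

/-!
# The number of geometric points in a fibre over the finite étale locus is the degree `[K(T) : K(S)]`
# (Harris Prop. 7.16, cardinality half; Görtz–Wedhorn I (12.6.1), Prop. 12.21)

Layer `Literature/AlgebraicGeometry/Morphisms`, namespace `Literature.AlgebraicGeometry.Morphisms`.  KERNEL ONLY: theorems;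
no definition, no named fact, no instance, no `sorry`.  Companion of ★ `Morphisms/EtaleLocusFibres` (fibres over the finite
étale locus are reduced) and ★ `Morphisms/EtaleLocusFibresCharZero` (in characteristic `0` such a locus exists): here the
CARDINALITY statement of [Harris1992] Prop. 7.16 — «for a general point `q ∈ S` the fibre `ψ⁻¹(q)` consists of exactly
`deg ψ = [K(T) : K(S)]` points».

For a dominant morphism `ψ : T ⟶ S` of integral schemes and an open `V ⊆ S` with `ψ ∣_ V` finite étale:

* `residueDegree_genericPoint_eq_finrank_functionFieldOver` — `[κ(ξ_T) : κ(ξ_S)] = [K(T) : K(S)]`: Mathlib's residue degree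
  `Scheme.Hom.residueDegree` at the generic point is the degree of the function-field extension `Motives.FunctionFieldOver ψ`
  (the residue fields at the generic points ARE the function fields, [GortzWedhorn2020] (11.16) / §(3.3)).
* `natCard_specOver_eq_natCard_specOver_morphismRestrict` — the `Ω`-points of `T` over a point `sb : Spec Ω → S` factoring
  through `V` are the `Ω`-points of `ψ⁻¹V` over the factorisation ([GortzWedhorn2020] (4.7.1), open immersions are monomorphisms).
* `natCard_specOver_eq_residueDegree_genericPoint`, `natCard_specOver_eq_finrank_functionFieldOver`,
  `natCard_specOver_eq_degree_of_isAlteration` — **for every geometric point `sb : Spec Ω → S` (`Ω` separably closed) landing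
  in `V`, `#{x : Spec Ω → T over sb} = [K(T) : K(S)]`** (= `IsAlteration.degree` for an alteration): ★
  `FiniteEtaleGeometricFibreCard.natCard_specOver_eq_finrank` (the count is the rank of `(ψ ∣_ V)_* 𝒪` at the image point,
  [GortzWedhorn2020] Prop. 12.21), ★ `HodgeTheory.finrank_eq_residueDegree_genericPoint` (that rank is `[κ(ξ) : κ(η)]`,
  [GortzWedhorn2020] (12.6.1)), ★ `HodgeTheory.residueDegree_morphismRestrict` (residue degrees do not see the restriction).
* `natCard_specOver_eq_natCard_specOver_of_mem` — hence all geometric fibres over `V` have the same number of points.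
* `exists_opens_finite_etale_natCard_eq_of_charZero` — joined with ★ `exists_opens_finite_etale_isReduced_of_charZero`: in
  characteristic `0`, a proper dominant `ψ` with finite non-empty closed fibres over a non-empty open is finite étale over a
  non-empty open `V`, with reduced fibres having exactly `[K(T) : K(S)]` geometric points ([Harris1992] Prop. 7.16 in full).

Consumer (cell `hodgecm-mathlib`, D-0151, road G4∕(E), [Lange2023AbelianVarietiesComplex] Lemma 4.4.4 Step I = [Milne1986JacobianVarieties]
Lemma 6.7): the incidence `ψ : C × W̃_{g−1} → J` has degree `g` and reduced general fibres with `g` points.  COUNT-NEUTRAL.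
HC_CM is proved only modulo the 7 printed citations until rung 0 closes.

## References
* [Harris1992] J. Harris, *Algebraic Geometry: A First Course*, GTM 133 (1992), Prop. 7.16 (p. 80).
* [GortzWedhorn2020] U. Görtz, T. Wedhorn, *Algebraic Geometry I* (2nd ed., 2020), (4.7.1) (p. 108), (12.6.1) and Prop. 12.21.
* [DeJong1996] A. J. de Jong, *Smoothness, semi-stability and alterations*, Publ. Math. IHÉS 83 (1996), 2.20 (p. 61).
* [Temkin2017] M. Temkin, *Tame distillation and desingularization by `p`-alterations*, Ann. of Math. 186 (2017), §1.1.2.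
-/

noncomputable section

universe u

open CategoryTheory CategoryTheory.Limits AlgebraicGeometry TopologicalSpace

namespace Literature.AlgebraicGeometry.Morphisms

/-! ### §1 The residue degree at the generic point is the degree of the function-field extension -/

section GenericResidueDegree

variable {X' X : Scheme.{u}} [IsIntegral X'] [IsIntegral X] (f : X' ⟶ X) [IsDominant f]

/-- **`[κ(ξ') : κ(f ξ')] = [K(X') : K(X)]`.**  For a dominant morphism `f : X' ⟶ X` of integral schemes with generic points
`ξ'`, `ξ = f ξ'`, Mathlib's residue degree of `f` at `ξ'` is the degree of the function-field extension `K(X')/K(X)` along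
`f^♯` (`Motives.FunctionFieldOver f`): the local rings at the generic points are the function fields, so their residue maps
`𝒪_{X,ξ} → κ(ξ)`, `𝒪_{X',ξ'} → κ(ξ')` are isomorphisms compatible with `f^♯` ([GortzWedhorn2020] §(3.3) and (11.16): `K(X) =
𝒪_{X,η} = κ(η)`; Mathlib `Algebra.finrank_eq_of_equiv_equiv`). [cite: GortzWedhorn2020, Section (11.16) and Section (12.6) (pp. 332–333)] -/
theorem residueDegree_genericPoint_eq_finrank_functionFieldOver :
    f.residueDegree (genericPoint X') = Module.finrank X.functionField (Motives.FunctionFieldOver f) := by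
  -- the specialisation `f ξ' ⤳ ξ` (an equality of points) through which `f^♯` is defined
  have hspec : f.base (genericPoint X') ⤳ genericPoint X := Motives.RatFn.specializes_genericPoint f
  -- `i : K(X) → κ(f ξ')`, a rational function ↦ its residue class at `f ξ' = ξ`
  let i₀ : X.functionField →+* X.residueField (f.base (genericPoint X')) :=
    (X.presheaf.stalkSpecializes hspec ≫ X.residue (f.base (genericPoint X'))).hom
  have hsurj : ∀ {x y : X} (_ : y = x) (h : x ⤳ y), Function.Surjective (X.presheaf.stalkSpecializes h) := by
    rintro x _ rfl h
    rw [TopCat.Presheaf.stalkSpecializes_refl]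
    exact Function.surjective_id
  have hi : Function.Bijective i₀ :=
    ⟨i₀.injective, (X.residue_surjective _).comp
      (hsurj (Motives.RatFn.genericPoint_eq_of_isDominant f).symm hspec)⟩
  -- `j : K(X') → κ(ξ')`, the residue map of the field `𝒪_{X',ξ'} = K(X')`
  let j₀ : Motives.FunctionFieldOver f →+* X'.residueField (genericPoint X') :=
    (X'.residue (genericPoint X')).hom
  have hj : Function.Bijective j₀ := ⟨j₀.injective, X'.residue_surjective _⟩
  unfold Scheme.Hom.residueDegree
  letI := (f.residueFieldMap (genericPoint X')).hom.toAlgebra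
  symm
  refine Algebra.finrank_eq_of_equiv_equiv (RingEquiv.ofBijective i₀ hi) (RingEquiv.ofBijective j₀ hj) ?_
  ext t
  change (f.residueFieldMap (genericPoint X')).hom
      ((X.residue (f.base (genericPoint X'))).hom ((X.presheaf.stalkSpecializes hspec).hom t)) =
    (X'.residue (genericPoint X')).hom ((f.stalkMap (genericPoint X')).hom ((X.presheaf.stalkSpecializes hspec).hom t))
  rw [← CommRingCat.comp_apply, Scheme.residue_residueFieldMap, CommRingCat.comp_apply]

end GenericResidueDegree

/-! ### §2 `Ω`-points over a point of the locus are `Ω`-points of the restriction -/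

section Restrict

variable {T S : Scheme.{u}} (ψ : T ⟶ S) (V : S.Opens)

/-- **`Hom_S(Spec Ω, T)` over a point of `V` = `Hom_V(Spec Ω, ψ⁻¹V)`.**  If `sb : Spec Ω → S` factors as `sb = sb' ≫ ι_V`
through the open `V`, composition with the open immersion `ψ⁻¹V ↪ T` is a bijection between the `Ω`-points of `ψ⁻¹ V` over
`sb'` (for `ψ ∣_ V`) and the `Ω`-points of `T` over `sb` (for `ψ`): an `Ω`-point of `T` over `sb` has image in `ψ⁻¹V` and
factors uniquely (Mathlib `IsOpenImmersion.lift`), and `ψ⁻¹V = T ×_S V` ([GortzWedhorn2020] (4.7.1):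
`Hom_S(Z, X) = Hom_{S'}(Z, X ×_S S')`).  Stated as an equality of `Nat.card`s. [cite: GortzWedhorn2020, Section (4.7), (4.7.1) (p. 108)] -/
theorem natCard_specOver_eq_natCard_specOver_morphismRestrict {Ω : Type u} [Field Ω]
    (sb : Spec (.of Ω) ⟶ S) (sb' : Spec (.of Ω) ⟶ (V : Scheme.{u})) (hsb : sb' ≫ V.ι = sb) :
    Nat.card {x : Spec (.of Ω) ⟶ T // x ≫ ψ = sb} =
      Nat.card {x : Spec (.of Ω) ⟶ (ψ ⁻¹ᵁ V : Scheme.{u}) // x ≫ (ψ ∣_ V) = sb'} := by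
  -- an `Ω`-point of `T` over `sb` has image in `ψ⁻¹ V`
  have hr : ∀ x : {x : Spec (.of Ω) ⟶ T // x ≫ ψ = sb},
      Set.range x.1.base ⊆ Set.range (ψ ⁻¹ᵁ V).ι.base := by
    rintro ⟨x, hx⟩ _ ⟨p, rfl⟩
    rw [Scheme.Opens.range_ι]
    have hp : ψ.base (x.base p) ∈ Set.range V.ι.base :=
      ⟨sb'.base p, by rw [← Scheme.Hom.comp_apply, hsb, ← hx, Scheme.Hom.comp_apply]⟩
    rw [Scheme.Opens.range_ι] at hp
    exact hp
  -- the factorisation lies over `sb'` (cancel the monomorphism `ι_V`)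
  have h1 : ∀ x : {x : Spec (.of Ω) ⟶ T // x ≫ ψ = sb},
      IsOpenImmersion.lift (ψ ⁻¹ᵁ V).ι x.1 (hr x) ≫ (ψ ∣_ V) = sb' := by
    intro x
    rw [← cancel_mono V.ι, Category.assoc, morphismRestrict_ι, ← Category.assoc, IsOpenImmersion.lift_fac, x.2, hsb]
  have h2 : ∀ x : {x : Spec (.of Ω) ⟶ (ψ ⁻¹ᵁ V : Scheme.{u}) // x ≫ (ψ ∣_ V) = sb'},
      (x.1 ≫ (ψ ⁻¹ᵁ V).ι) ≫ ψ = sb := by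
    intro x
    rw [Category.assoc, ← morphismRestrict_ι, ← Category.assoc, x.2, hsb]
  exact Nat.card_congr
    { toFun := fun x => ⟨IsOpenImmersion.lift (ψ ⁻¹ᵁ V).ι x.1 (hr x), h1 x⟩
      invFun := fun x => ⟨x.1 ≫ (ψ ⁻¹ᵁ V).ι, h2 x⟩
      left_inv := fun x => Subtype.ext (IsOpenImmersion.lift_fac _ _ _)
      right_inv := fun x => Subtype.ext (by
        rw [← cancel_mono (ψ ⁻¹ᵁ V).ι]
        exact IsOpenImmersion.lift_fac _ _ _) }

end Restrict

/-! ### §3 The number of geometric points over the finite étale locus is `[K(T) : K(S)]` -/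

section Card

variable {T S : Scheme.{u}} (ψ : T ⟶ S) [IsIntegral T] [IsIntegral S] [IsDominant ψ] (V : S.Opens)

/-- **`#ψ⁻¹(s̄) = [κ(ξ_T) : κ(ξ_S)]` over the finite étale locus.**  For a dominant `ψ : T ⟶ S` of integral schemes, an open
`V ⊆ S` with `ψ ∣_ V` finite étale, and a geometric point `sb : Spec Ω → S` (`Ω` separably closed) whose image point lies in
`V`, the number of `Ω`-points of `T` over `sb` is the residue degree of `ψ` at the generic point: the count is the rank of
`(ψ ∣_ V)_* 𝒪` at the image point (★ `natCard_specOver_eq_finrank`, [GortzWedhorn2020] Prop. 12.21), that rank is constant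
`= [κ(ξ_{ψ⁻¹V}) : κ(ξ_V)]` (★ `HodgeTheory.finrank_eq_residueDegree_genericPoint`, [GortzWedhorn2020] (12.6.1)), and
residue degrees do not see the restriction (★ `HodgeTheory.residueDegree_morphismRestrict`).
[cite: Harris1992, Prop. 7.16 (p. 80)] [cite: GortzWedhorn2020, Prop. 12.21 and (12.6.1) (p. 333)] -/
theorem natCard_specOver_eq_residueDegree_genericPoint [IsFinite (ψ ∣_ V)] [Etale (ψ ∣_ V)]
    {Ω : Type u} [Field Ω] [IsSepClosed Ω] (sb : Spec (.of Ω) ⟶ S)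
    (hs : sb.base (IsLocalRing.closedPoint Ω) ∈ V) :
    Nat.card {x : Spec (.of Ω) ⟶ T // x ≫ ψ = sb} = ψ.residueDegree (genericPoint T) := by
  -- factor `sb` through `V`
  let sb' : Spec (.of Ω) ⟶ (V : Scheme.{u}) :=
    IsOpenImmersion.lift V.ι sb (by
      rw [Scheme.Opens.range_ι]
      exact range_subset_of_apply_closedPoint_mem V sb hs)
  have hsb : sb' ≫ V.ι = sb := IsOpenImmersion.lift_fac _ _ _
  rw [natCard_specOver_eq_natCard_specOver_morphismRestrict ψ V sb sb' hsb,
    natCard_specOver_eq_finrank (ψ ∣_ V) sb']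
  -- the generic points of `V` and `ψ⁻¹ V`
  have hωV : genericPoint S ∈ V :=
    ((genericPoint_spec S).mem_open_set_iff V.isOpen).mpr ⟨_, Set.mem_univ _, hs⟩
  have hθV : genericPoint T ∈ ψ ⁻¹ᵁ V := Motives.RatFn.genericPoint_mem_preimage ψ hωV
  haveI : Nonempty (V : Scheme.{u}) := ⟨(⟨_, hωV⟩ : ↥V)⟩
  haveI : Nonempty (ψ ⁻¹ᵁ V : Scheme.{u}) := ⟨(⟨_, hθV⟩ : ↥(ψ ⁻¹ᵁ V))⟩
  haveI : IsIntegral (V : Scheme.{u}) := isIntegral_of_isOpenImmersion V.ι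
  haveI : IsIntegral (ψ ⁻¹ᵁ V : Scheme.{u}) := isIntegral_of_isOpenImmersion (ψ ⁻¹ᵁ V).ι
  have hθ' : (⟨genericPoint T, hθV⟩ : ↥(ψ ⁻¹ᵁ V)) = genericPoint (ψ ⁻¹ᵁ V : Scheme.{u}) := by
    apply (ψ ⁻¹ᵁ V).ι.isOpenEmbedding.injective
    rw [Scheme.Opens.ι_apply, genericPoint_eq_of_isOpenImmersion (ψ ⁻¹ᵁ V).ι]
  have hω' : (⟨genericPoint S, hωV⟩ : ↥V) = genericPoint (V : Scheme.{u}) := by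
    apply V.ι.isOpenEmbedding.injective
    rw [Scheme.Opens.ι_apply, genericPoint_eq_of_isOpenImmersion V.ι]
  have hf : (ψ ∣_ V).base (genericPoint (ψ ⁻¹ᵁ V : Scheme.{u})) = genericPoint (V : Scheme.{u}) := by
    rw [← hθ', ← hω']
    apply Subtype.ext
    rw [morphismRestrict_base_coe]
    exact Motives.RatFn.genericPoint_eq_of_isDominant ψ
  -- `ψ ∣_ V` is finite, flat and locally of finite presentation (étale)
  rw [HodgeTheory.finrank_eq_residueDegree_genericPoint (ψ ∣_ V) hf, ← hθ',
    HodgeTheory.residueDegree_morphismRestrict]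

/-- **[Harris1992] Prop. 7.16, cardinality half: `#ψ⁻¹(s̄) = deg ψ = [K(T) : K(S)]` over the finite étale locus.**  For a
dominant `ψ : T ⟶ S` of integral schemes, finite étale over the open `V ⊆ S`, every geometric point `sb : Spec Ω → S`
(`Ω` separably closed) with image in `V` has exactly `[K(T) : K(S)]` points of `T(Ω)` over it («if `π : X → Y` is
generically finite of degree `d`, for general `q ∈ Y` the fibre consists of `d` points», char. `0` being needed only to
FIND such a `V`). [cite: Harris1992, Prop. 7.16 (p. 80)] [cite: GortzWedhorn2020, Prop. 12.21 and (12.6.1) (p. 333)] -/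
theorem natCard_specOver_eq_finrank_functionFieldOver [IsFinite (ψ ∣_ V)] [Etale (ψ ∣_ V)]
    {Ω : Type u} [Field Ω] [IsSepClosed Ω] (sb : Spec (.of Ω) ⟶ S)
    (hs : sb.base (IsLocalRing.closedPoint Ω) ∈ V) :
    Nat.card {x : Spec (.of Ω) ⟶ T // x ≫ ψ = sb} =
      Module.finrank S.functionField (Motives.FunctionFieldOver ψ) := by
  rw [natCard_specOver_eq_residueDegree_genericPoint ψ V sb hs,
    residueDegree_genericPoint_eq_finrank_functionFieldOver ψ]

/-- The same for an ALTERATION `ψ`, with the tree's `IsAlteration.degree ψ = [K(T) : K(S)]` ([DeJong1996] 2.20;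
[Temkin2017] §1.1.2): over the finite étale locus every geometric fibre has exactly `deg ψ` points.
[cite: Harris1992, Prop. 7.16 (p. 80)] [cite: DeJong1996, 2.20, p. 61] [cite: Temkin2017, §1.1.2 (arXiv:1508.06255v2 p. 2)] -/
theorem natCard_specOver_eq_degree_of_isAlteration (h : Resolution.IsAlteration ψ) [IsFinite (ψ ∣_ V)] [Etale (ψ ∣_ V)]
    {Ω : Type u} [Field Ω] [IsSepClosed Ω] (sb : Spec (.of Ω) ⟶ S)
    (hs : sb.base (IsLocalRing.closedPoint Ω) ∈ V) :
    Nat.card {x : Spec (.of Ω) ⟶ T // x ≫ ψ = sb} = h.degree := by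
  rw [h.degree_eq_finrank]
  exact natCard_specOver_eq_finrank_functionFieldOver ψ V sb hs

/-- **All geometric fibres over the finite étale locus have the same number of points** (two separably closed fields
`Ω₁`, `Ω₂`, possibly different, e.g. of different cardinality): both counts are `[K(T) : K(S)]`.
[cite: Harris1992, Prop. 7.16 (p. 80)] [cite: GortzWedhorn2020, (12.6.1) (p. 333)] -/
theorem natCard_specOver_eq_natCard_specOver_of_mem [IsFinite (ψ ∣_ V)] [Etale (ψ ∣_ V)]
    {Ω₁ Ω₂ : Type u} [Field Ω₁] [IsSepClosed Ω₁] [Field Ω₂] [IsSepClosed Ω₂]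
    (sb₁ : Spec (.of Ω₁) ⟶ S) (sb₂ : Spec (.of Ω₂) ⟶ S)
    (h₁ : sb₁.base (IsLocalRing.closedPoint Ω₁) ∈ V) (h₂ : sb₂.base (IsLocalRing.closedPoint Ω₂) ∈ V) :
    Nat.card {x : Spec (.of Ω₁) ⟶ T // x ≫ ψ = sb₁} = Nat.card {x : Spec (.of Ω₂) ⟶ T // x ≫ ψ = sb₂} := by
  rw [natCard_specOver_eq_finrank_functionFieldOver ψ V sb₁ h₁,
    natCard_specOver_eq_finrank_functionFieldOver ψ V sb₂ h₂]

end Card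

/-! ### §4 Characteristic `0`: Harris Prop. 7.16 in full -/

section CharZero

variable {T S : Scheme.{u}} (ψ : T ⟶ S) [IsIntegral T] [IsIntegral S] [IsDominant ψ] [IsProper ψ]
  [LocallyOfFinitePresentation ψ] [JacobsonSpace S] [CharZero S.functionField]

/-- **[Harris1992] Prop. 7.16 (characteristic `0`).**  Let `ψ : T ⟶ S` be proper, dominant and locally of finite
presentation between integral schemes, `S` Jacobson with `char K(S) = 0`, and let `U ⊆ S` be a non-empty open over whose
closed points the fibres of `ψ` are finite and non-empty.  Then there is a non-empty open `V ⊆ S` over which `ψ` is FINITE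
ÉTALE, every fibre `ψ⁻¹(s)` (`s ∈ V`) is reduced, and every geometric point `sb : Spec Ω → S` (`Ω` separably closed) with
image in `V` has exactly `deg ψ = [K(T) : K(S)]` points of `T(Ω)` over it (★ `exists_opens_finite_etale_isReduced_of_charZero`
— de Jong 2.20 «separable ⇒ generically étale» — and `natCard_specOver_eq_finrank_functionFieldOver`).
[cite: Harris1992, Prop. 7.16 (p. 80)] [cite: DeJong1996, 2.20, p. 61] [cite: GortzWedhorn2020, Prop. 12.21 and (12.6.1) (p. 333)] -/
theorem exists_opens_finite_etale_natCard_eq_of_charZero (U : S.Opens) (hU : (U : Set S).Nonempty)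
    (hfin : ∀ s : S, s ∈ U → IsClosed ({s} : Set S) → (ψ.base ⁻¹' {s}).Finite)
    (hne : ∀ s : S, s ∈ U → IsClosed ({s} : Set S) → (ψ.base ⁻¹' {s}).Nonempty) :
    ∃ V : S.Opens, (V : Set S).Nonempty ∧ IsFinite (ψ ∣_ V) ∧ Etale (ψ ∣_ V) ∧
      (∀ s : S, s ∈ V → IsReduced (ψ.fiber s : Scheme.{u})) ∧
      ∀ (Ω : Type u) [Field Ω] [IsSepClosed Ω] (sb : Spec (.of Ω) ⟶ S),
        sb.base (IsLocalRing.closedPoint Ω) ∈ V →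
          Nat.card {x : Spec (.of Ω) ⟶ T // x ≫ ψ = sb} =
            Module.finrank S.functionField (Motives.FunctionFieldOver ψ) := by
  obtain ⟨V, hV, hfinV, hetV, hred, -⟩ := exists_opens_finite_etale_isReduced_of_charZero ψ U hU hfin hne
  exact ⟨V, hV, hfinV, hetV, hred, fun Ω _ _ sb hs =>
    natCard_specOver_eq_finrank_functionFieldOver ψ V sb hs⟩

end CharZero

end Literature.AlgebraicGeometry.Morphisms

end
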